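import Mathlib
import HarnessLib
import Summits.Ventures.LatticeQCDFlow.Exactness.SphereFlowResidualAction
import Summits.Ventures.LatticeQCDFlow.Exactness.SphereTimeDependentFlowMap

/-!
# Liouville's theorem and flow-HMC exactness as equalities of measures on the product of spheres: `(Φ_{s→c})_*(e^{ℓ_{s→c}}π̄) = π̄`, `(Φ_{s→c})_*(e^{−S_eff}π̄/Z) = e^{−tS}π̄/Z_t` for `S_eff = tS∘Φ_{s→c} − ℓ_{s→c}`, and `(Φ_{s→c})_*(e^{−sS}π̄/Z_s) = e^{−cS}π̄/Z_c` under Lüscher's equation between `s` and `c`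

HONEST FRAMING: exact (Metropolis-corrected) sampling algorithms for lattice gauge theory;
figures of merit are autocorrelation/cost numbers at stated couplings and volumes; no
continuum-physics claim.

Venture `LatticeQCDFlow` (cell pub-lqcd), topic `Exactness`; FANOUT row 7 (`s0-cpn-null`: the
S0-D1 rung — 2D CP⁹, Lüscher's LO trivializing map inside HMC, Engel–Schaefer 2011).  NEW WORK of
the cell over the tree's `Exactness/SphereFlowResidualAction.lean` (this leg: the weak forms with
`C¹` test functionals — Liouville `∫e^{ℓ_{s→c}}H∘Φ_{s→c}dπ̄ = ∫H dπ̄`, exact reweighting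
`⟨H∘Φ_{s→c}⟩_{S_eff} = ⟨H⟩_{tS}`, Lüscher's theorem between two flow times),
`Exactness/SphereTimeDependentFlowMap.lean` (GEN-14: the evolution maps `sphereTDFlowMap` on
`Ω = S(E)^Λ` itself, measurable) and `Exactness/SphereLuscherTrivializationMeasure.lean` (GEN-14:
probability measures on `Ω` are determined by the `C¹` functionals of the ambient space); nothing
is cited as a fact.  Printed counterpart, NAMED ONLY: M. Lüscher, Commun. Math. Phys. 293 (2010)
899, §3 (3.4)–(3.9); Engel–Schaefer 2011 §3 eq. (18).

THIS FILE upgrades the three weak identities to EQUALITIES OF PROBABILITY MEASURES ON `Ω`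
(`π̄ = ⊗_Λ σ̄`, `Φ_{s→c} = sphereTDFlowMap hG T s c`, `|s|, |c| ≤ |T| + 1`, `G` jointly `C³`):

* **`map_sphereTDFlowMap_tilted_logJac`** — LIOUVILLE: `(Φ_{s→c})_*(π̄.tilted ℓ_{s→c}) = π̄`; since
  `∫e^{ℓ_{s→c}}dπ̄ = 1` (**`integral_exp_sphereTDFlowLogJac`**) the tilt is the plain density
  `e^{ℓ_{s→c}}` — the Jacobian of `Φ_{s→c}`;
* **`map_sphereTDFlowMap_tilted_effAction`** — FLOW-HMC EXACTNESS: for `S ∈ C¹` and real `t`,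
  `(Φ_{s→c})_*(π̄.tilted(ℓ_{s→c} − tS∘Φ_{s→c})) = π̄.tilted(−tS)`: sampling the Gibbs measure of the
  effective action `S_eff = tS∘Φ_{s→c} − ℓ_{s→c}` (by any exact method, e.g. HMC in the flowed
  variables with its accept/reject step) and applying the map yields EXACTLY `e^{−tS}π̄/Z_t` — for
  EVERY jointly `C³` generator, trivializing or not;
* **`map_sphereTDFlowMap_tilted_eq_tilted_of_luscher`** — LÜSCHER'S THEOREM BETWEEN TWO FLOW TIMES:
  if `𝓛_uG_u = S + C_u` on `Ω` for `u` between `s` and `c`, `(Φ_{s→c})_*(π̄.tilted(−sS)) = π̄.tilted(−cS)`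
  (GEN-14's `map_sphereTDFlowMap_eq_tilted` is `s = 0`).

NOT CLAIMED: bounded-measurable statements about `Φ` beyond what equality of the measures gives;
generators only jointly `C²`; acceptance rates / variance of `S_eff − tS∘Φ`; anything quantitative,
about autocorrelations or the rung's numbers.
-/

noncomputable section

namespace Summit.Ventures.LatticeQCDFlow.Exactness

open Function Set Metric MeasureTheory NormedSpace InnerProductSpace
open scoped RealInnerProductSpace Topology

variable {Λ : Type*} {E : Type*} [NormedAddCommGroup E] [InnerProductSpace ℝ E]
  [FiniteDimensional ℝ E] [Fintype Λ] [DecidableEq Λ] [MeasurableSpace E] [BorelSpace E]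
  [Nontrivial E] {G : ℝ → (Λ → E) → ℝ} {T : ℝ}

/-! ## §1 Tilting by a continuous exponent on `Ω` -/

omit [DecidableEq Λ] [Nontrivial E] in
/-- Integrals against `π̄` tilted by a continuous exponent `f`: `∫ g d(π̄.tilted f) = ∫ e^f g dπ̄ / ∫ e^f dπ̄`. -/
theorem integral_spherePi_tilted (f : (Λ → sphere (0 : E) 1) → ℝ) (g : (Λ → sphere (0 : E) 1) → ℝ) :
    ∫ ω, g ω ∂(Measure.pi (fun _ : Λ => uniformSphere (volume : Measure E))).tilted f =
      (∫ ω, Real.exp (f ω) * g ω ∂Measure.pi (fun _ : Λ => uniformSphere (volume : Measure E))) /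
        ∫ ω, Real.exp (f ω) ∂Measure.pi (fun _ : Λ => uniformSphere (volume : Measure E)) := by
  rw [integral_tilted, ← integral_div]
  refine integral_congr_ae (ae_of_all _ fun ω => ?_)
  simp only [smul_eq_mul, div_mul_eq_mul_div]

omit [DecidableEq Λ] in
/-- `π̄` tilted by a continuous exponent is a probability measure. -/
theorem isProbabilityMeasure_spherePi_tilted {f : (Λ → sphere (0 : E) 1) → ℝ} (hf : Continuous f) :
    IsProbabilityMeasure ((Measure.pi (fun _ : Λ => uniformSphere (volume : Measure E))).tilted f) :=
  isProbabilityMeasure_tilted (integrable_pi_of_continuous _ (Real.continuous_exp.comp hf))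

/-! ## §2 Liouville's theorem as an equality of measures -/

/-- **`∫ e^{ℓ_{s→c}} dπ̄ = 1`**: the Jacobian density has total mass one (Liouville with `H = 1`). -/
theorem integral_exp_sphereTDFlowLogJac (hG : ContDiff ℝ 2 fun q : ℝ × (Λ → E) => G q.1 q.2)
    (hG3 : ContDiff ℝ 3 fun q : ℝ × (Λ → E) => G q.1 q.2) {s c : ℝ} (hs : |s| ≤ |T| + 1)
    (hc : |c| ≤ |T| + 1) :
    ∫ ω, Real.exp (sphereTDFlowLogJac hG T s c (fun m => ((ω : Λ → sphere (0 : E) 1) m : E)))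
        ∂Measure.pi (fun _ : Λ => uniformSphere (volume : Measure E)) = 1 := by
  have h := integral_exp_sphereTDFlowLogJac_mul_comp_sphereTDFlow hG hG3
    (contDiff_const (c := (1 : ℝ))) hs hc (T := T)
  simp only [mul_one, integral_const, smul_eq_mul, probReal_univ] at h
  exact h

omit [MeasurableSpace E] [BorelSpace E] [Nontrivial E] in
/-- The log-Jacobian read on `Ω` is continuous. -/
theorem continuous_sphereTDFlowLogJac_sphereConfig
    (hG : ContDiff ℝ 2 fun q : ℝ × (Λ → E) => G q.1 q.2)
    (hG3 : ContDiff ℝ 3 fun q : ℝ × (Λ → E) => G q.1 q.2) (s c : ℝ) :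
    Continuous fun ω : Λ → sphere (0 : E) 1 =>
      sphereTDFlowLogJac hG T s c (fun m => (ω m : E)) :=
  (contDiff_sphereTDFlowLogJac_apply hG hG3 s c (T := T)).continuous.comp continuous_sphereConfig

/-- **LIOUVILLE'S THEOREM AS AN EQUALITY OF MEASURES ON `Ω`.**  For a jointly `C³` generator and
`|s|, |c| ≤ |T| + 1`: `(Φ_{s→c})_*(π̄.tilted ℓ_{s→c}) = π̄` — the evolution map pushes the product
measure weighted by its Jacobian `e^{ℓ_{s→c}}` (a probability density, no normalisation needed)
forward to the product measure. -/
theorem map_sphereTDFlowMap_tilted_logJac (hG : ContDiff ℝ 2 fun q : ℝ × (Λ → E) => G q.1 q.2)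
    (hG3 : ContDiff ℝ 3 fun q : ℝ × (Λ → E) => G q.1 q.2) {s c : ℝ} (hs : |s| ≤ |T| + 1)
    (hc : |c| ≤ |T| + 1) :
    Measure.map (sphereTDFlowMap hG T s c)
        ((Measure.pi (fun _ : Λ => uniformSphere (volume : Measure E))).tilted
          fun ω => sphereTDFlowLogJac hG T s c (fun m => (ω m : E))) =
      Measure.pi (fun _ : Λ => uniformSphere (volume : Measure E)) := by
  haveI := isProbabilityMeasure_spherePi_tilted
    (continuous_sphereTDFlowLogJac_sphereConfig hG hG3 s c (T := T))
  haveI : IsProbabilityMeasure (Measure.map (sphereTDFlowMap hG T s c)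
      ((Measure.pi (fun _ : Λ => uniformSphere (volume : Measure E))).tilted
        fun ω => sphereTDFlowLogJac hG T s c (fun m => (ω m : E)))) :=
    Measure.isProbabilityMeasure_map (measurable_sphereTDFlowMap hG T s c).aemeasurable
  refine measure_sphereConfig_ext_of_forall_integral_contDiff_eq fun H hH => ?_
  have hcH : Continuous fun ω : Λ → sphere (0 : E) 1 => H (fun n => (ω n : E)) :=
    hH.continuous.comp continuous_sphereConfig
  rw [integral_map (measurable_sphereTDFlowMap hG T s c).aemeasurable hcH.aestronglyMeasurable]
  simp only [coe_sphereTDFlowMap_eq]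
  rw [integral_spherePi_tilted, integral_exp_sphereTDFlowLogJac hG hG3 hs hc, div_one,
    integral_exp_sphereTDFlowLogJac_mul_comp_sphereTDFlow hG hG3 hH hs hc]

/-! ## §3 Flow-HMC exactness as an equality of measures -/

/-- **FLOW-HMC EXACTNESS AS AN EQUALITY OF MEASURES ON `Ω`.**  For a jointly `C³` generator,
`S ∈ C¹`, real `t` and `|s|, |c| ≤ |T| + 1`, with the effective action
`S_eff = tS∘Φ_{s→c} − ℓ_{s→c}`:
`(Φ_{s→c})_*(π̄.tilted(−S_eff)) = π̄.tilted(−tS)` — mapping exact samples of `e^{−S_eff}π̄/Z` through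
`Φ_{s→c}` gives exact samples of `e^{−tS}π̄/Z_t`, whatever the generator. -/
theorem map_sphereTDFlowMap_tilted_effAction (hG : ContDiff ℝ 2 fun q : ℝ × (Λ → E) => G q.1 q.2)
    (hG3 : ContDiff ℝ 3 fun q : ℝ × (Λ → E) => G q.1 q.2) {S : (Λ → E) → ℝ} (hS : ContDiff ℝ 1 S)
    (t : ℝ) {s c : ℝ} (hs : |s| ≤ |T| + 1) (hc : |c| ≤ |T| + 1) :
    Measure.map (sphereTDFlowMap hG T s c)
        ((Measure.pi (fun _ : Λ => uniformSphere (volume : Measure E))).tilted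
          fun ω => sphereTDFlowLogJac hG T s c (fun m => (ω m : E)) -
            t * S (sphereTDFlow hG T s c (fun m => (ω m : E)))) =
      (Measure.pi (fun _ : Λ => uniformSphere (volume : Measure E))).tilted
        fun ω => -(t * S (fun m => (ω m : E))) := by
  have hcont : Continuous fun ω : Λ → sphere (0 : E) 1 =>
      sphereTDFlowLogJac hG T s c (fun m => (ω m : E)) -
        t * S (sphereTDFlow hG T s c (fun m => (ω m : E))) :=
    (continuous_sphereTDFlowLogJac_sphereConfig hG hG3 s c (T := T)).sub
      (continuous_const.mul ((hS.continuous.comp (contDiff_sphereTDFlow_apply hG s c).continuous).comp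
        continuous_sphereConfig))
  haveI := isProbabilityMeasure_spherePi_tilted hcont
  haveI := isProbabilityMeasure_tilted_neg_action (Λ := Λ) hS.continuous t
  haveI : IsProbabilityMeasure (Measure.map (sphereTDFlowMap hG T s c)
      ((Measure.pi (fun _ : Λ => uniformSphere (volume : Measure E))).tilted
        fun ω => sphereTDFlowLogJac hG T s c (fun m => (ω m : E)) -
          t * S (sphereTDFlow hG T s c (fun m => (ω m : E))))) :=
    Measure.isProbabilityMeasure_map (measurable_sphereTDFlowMap hG T s c).aemeasurable
  refine measure_sphereConfig_ext_of_forall_integral_contDiff_eq fun H hH => ?_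
  have hcH : Continuous fun ω : Λ → sphere (0 : E) 1 => H (fun n => (ω n : E)) :=
    hH.continuous.comp continuous_sphereConfig
  rw [integral_map (measurable_sphereTDFlowMap hG T s c).aemeasurable hcH.aestronglyMeasurable]
  simp only [coe_sphereTDFlowMap_eq]
  rw [integral_spherePi_tilted, integral_spherePi_tilted,
    tiltedMean_effAction_comp_sphereTDFlow_eq hG hG3 hS hH t hs hc]

/-! ## §4 Lüscher's theorem between two flow times as an equality of measures -/

/-- **LÜSCHER'S THEOREM BETWEEN TWO FLOW TIMES, MEASURE FORM.**  Let `G` be jointly `C³`, `S ∈ C¹`,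
`|s|, |c| ≤ |T| + 1`, and `𝓛_uG_u = S + C_u` on `Ω` for every `u` between `s` and `c`.  Then
`(Φ_{s→c})_*(π̄.tilted(−sS)) = π̄.tilted(−cS)`: the evolution map carries the tilted law at time `s`
to the tilted law at time `c`. -/
theorem map_sphereTDFlowMap_tilted_eq_tilted_of_luscher
    (hG : ContDiff ℝ 2 fun q : ℝ × (Λ → E) => G q.1 q.2)
    (hG3 : ContDiff ℝ 3 fun q : ℝ × (Λ → E) => G q.1 q.2) {S : (Λ → E) → ℝ} (hS : ContDiff ℝ 1 S)
    {s c : ℝ} (hs : |s| ≤ |T| + 1) (hc : |c| ≤ |T| + 1) {C : ℝ → ℝ}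
    (hsol : ∀ u ∈ uIcc s c, ∀ ω : Λ → sphere (0 : E) 1,
      sphereLuscherL S u (G u) (fun m => (ω m : E)) = S (fun m => (ω m : E)) + C u) :
    Measure.map (sphereTDFlowMap hG T s c)
        ((Measure.pi (fun _ : Λ => uniformSphere (volume : Measure E))).tilted
          fun ω => -(s * S (fun m => (ω m : E)))) =
      (Measure.pi (fun _ : Λ => uniformSphere (volume : Measure E))).tilted
        fun ω => -(c * S (fun m => (ω m : E))) := by
  haveI := isProbabilityMeasure_tilted_neg_action (Λ := Λ) hS.continuous s
  haveI := isProbabilityMeasure_tilted_neg_action (Λ := Λ) hS.continuous c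
  haveI : IsProbabilityMeasure (Measure.map (sphereTDFlowMap hG T s c)
      ((Measure.pi (fun _ : Λ => uniformSphere (volume : Measure E))).tilted
        fun ω => -(s * S (fun m => (ω m : E))))) :=
    Measure.isProbabilityMeasure_map (measurable_sphereTDFlowMap hG T s c).aemeasurable
  refine measure_sphereConfig_ext_of_forall_integral_contDiff_eq fun H hH => ?_
  have hcH : Continuous fun ω : Λ → sphere (0 : E) 1 => H (fun n => (ω n : E)) :=
    hH.continuous.comp continuous_sphereConfig
  rw [integral_map (measurable_sphereTDFlowMap hG T s c).aemeasurable hcH.aestronglyMeasurable]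
  simp only [coe_sphereTDFlowMap_eq]
  rw [integral_tilted_neg_action, integral_tilted_neg_action,
    tiltedMean_comp_sphereTDFlow_eq_of_luscher hG hG3 hS hH hs hc hsol]

end Summit.Ventures.LatticeQCDFlow.Exactness

end
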